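import Summits.BirchSwinnertonDyer.BirchSwinnertonDyer.Theorems.QuadraticBranchSignedControlPlusEtaLowerInclusionValuationSqueeze
import HarnessLib

/-!
# Route `QuadraticBranchSignedControl` (rung K8, cell `bsd-potss`), crux `PlusEtaLowerInclusion`
# (item stmt-BirchSwinnertonDyer-19601): the ORDER-OF-VANISHING conjunct of Kobayashi's even main
# conjecture at `η` on a tower-onto pair, from the analytic non-vanishing certificate alone

WHAT. Companion of `…PlusEtaLowerInclusionValuationSqueeze.lean` (p499967). There the crux (E⁺_η) at a
tower-onto pair of Mordell–Weil rank `r = rank V^{(p*)}(ℚ)` was reduced to ONE inequality between the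
`r`-th coefficients of a characteristic power series `ξ_η` of `X⁺(V/K_∞)^η` and of `L_p⁺(V, η, T)`. THIS
FILE records what the ANALYTIC certificate gives by itself, with NO algebraic input: if the `r`-th
coefficient of `L_p⁺(V, η, T)` is non-zero (a finite computation per pair), then, GRANTED Kobayashi's
Thm. 1.2 / 1.3 / 2.2(η) / 4.1(η) (NAMED facts), the tower onto and the `V`-certificate,

  `ord_{T=0} ξ_η = r = ord_{T=0} L_p⁺(V, η, T)`   (`T^r ∣ ξ_η`, `T^{r+1} ∤ ξ_η`, same for `Lη`)

— the ORDER conjunct of `Char(X⁺(V/K_∞)^η) = (L_p⁺(V,η,X))` at the pair ("`p`-adic BSD, rank part, at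
`η`", both sides): `T^r ∣ ξ_η ∣ Lη` (the `η`-rank bound of the companion file + Thm. 4.1 at `η`) and
`coeff_r Lη ≠ 0`. On the programme's 21 rank-one tower-onto rows this is dischargeable per pair by the
kit census of `(L_p⁺(V,η,T))'(0)` (evidence on the item), leaving EXACTLY the valuation of the linear
coefficients as the open content of the crux there.

HONEST FRAMING (cell `bsd-potss`, run/shared/lean/pub/bsd-potss/; FULL-BSD rank ≤ 1 programme, HUMAN
RULING D-0036/D-0074): TOOL THEOREMS ONLY, CONDITIONAL on the named Literature facts (hypothesis
position), the tower-onto hypothesis, the `V`-certificate and the displayed analytic certificate (NOT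
supplied here for any pair). The crux 19601 is OPEN class-wide and NOT closed; nothing is booked;
`BSD(W, p)` is claimed for no pair. No definition, no named fact, no `sorry`, axioms standard. Seat
`bsd-potss-k8eta-c1` (prover), g3; `--supports stmt-BirchSwinnertonDyer-19601`.

References: [Kobayashi2003] Thm. 1.2/1.3 (p. 2), Thm. 2.2 (p. 5), §4 + Thm. 4.1 (p. 8);
[GreenbergLNM1716] §1 p. 65, §3 Lemma 3.1; [Washington1997] §13.2.
-/

set_option autoImplicit false
set_option linter.dupNamespace false
noncomputable section

open scoped Classical

open CongruenceSubgroup Field WeierstrassCurve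
open Literature.NumberTheory.EllipticCurves
open Literature.NumberTheory.EllipticCurves.ModularForms
open Literature.NumberTheory.GaloisRepresentations
open Summit.BirchSwinnertonDyer.Rank1Residual.Additive

namespace Summit.BirchSwinnertonDyer.BirchSwinnertonDyer.Theorems

section Algebra

variable {p : ℕ} [Fact p.Prime]

/-- In `Λ = ℤ_p⟦T⟧`: if `ξ ∣ L` and the `r`-th coefficient of `L` is non-zero, then `T^{r+1}` divides
neither `ξ` nor `L` (with `T^r ∣ ξ`: both have order of vanishing exactly `r` at `T = 0`).
[cite: Washington1997, §13.2 (Λ = ℤ_p⟦T⟧)] -/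
theorem not_X_pow_succ_dvd_of_dvd_of_coeff_ne_zero {r : ℕ} {ξ L : IwasawaAlgebra p} (hξL : ξ ∣ L)
    (hL : PowerSeries.coeff r L ≠ 0) :
    ¬ (PowerSeries.X : IwasawaAlgebra p) ^ (r + 1) ∣ ξ ∧
      ¬ (PowerSeries.X : IwasawaAlgebra p) ^ (r + 1) ∣ L := by
  have hLX : ¬ (PowerSeries.X : IwasawaAlgebra p) ^ (r + 1) ∣ L := by
    rintro ⟨c, rfl⟩
    apply hL
    rw [PowerSeries.X_pow_mul]
    exact PowerSeries.coeff_mul_X_pow' c (r + 1) r ▸ by simp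
  exact ⟨fun h => hLX (h.trans hξL), hLX⟩

end Algebra

section Pair

variable {V : WeierstrassCurve ℚ} [V.IsElliptic] [V.IsGloballyMinimal] {p : ℕ} [Fact p.Prime]

/-- **ORDER OF VANISHING AT `η` ON A TOWER-ONTO PAIR.** GRANTED Kobayashi's Thm. 1.2 (`h12`), Thm. 1.3
(`h13`), Thm. 2.2 at `η` (`h22`), Thm. 4.1 at `η` (`h41`) (NAMED facts), on a good `a_p = 0` pair with
`p ≥ 5`, `ρ_{V,p^m}` onto for all `m` and the `V`-certificate `hcertV`: if the `r`-th coefficient of a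
branch function `Lη = L_p⁺(V, η, T)` is non-zero, `r = rank V^{(p*)}(ℚ)` (`hne`, per pair a finite
computation), then for every `η`-datum `D` and every generator `g` of `Char(D.X)`:
`T^r ∣ g`, `T^{r+1} ∤ g`, `T^r ∣ Lη`, `T^{r+1} ∤ Lη` — both sides of the even main conjecture at `η`
vanish to order EXACTLY `r` at `T = 0`. CONDITIONAL on the displayed inputs; closes nothing.
[cite: Kobayashi2003, Thm. 1.2 and Thm. 1.3 (p. 2), Thm. 2.2 (p. 5), Thm. 4.1 and §4 (p. 8)]
[cite: GreenbergLNM1716, §1 p. 65 and §3 Lemma 3.1] -/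
theorem ordT_etaCharGenerator_eq_twistRank_of_namedFacts_of_certV_of_coeff_ne_zero
    (h12 : Kobayashi2003.thm12_signedSelmerDual_finite_torsion)
    (h13 : Kobayashi2003.thm41_signedCharIdeal_divisibility)
    (h22 : Kobayashi2003.thm22_etaSignedSelmerDual_finite_torsion)
    (h41 : Kobayashi2003.thm41_plusEtaCharIdeal_dvd)
    (hp5 : 5 ≤ p) (hgood : V.HasGoodReductionAtPrime p) (hap : V.frobeniusTrace p = 0)
    (hsurj : ∀ m : ℕ, V.HasSurjectiveModNGaloisRep (p ^ m : ℕ))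
    (hcertV : ∀ {N : ℕ} [NeZero N] (f : CuspForm (Gamma0 N) 2), IsNewformOf V f →
      ∃ L : IwasawaAlgebra p, Kobayashi2003.IsSignedPAdicLFunction f p 1 L ∧
        IsUnit (PowerSeries.coeff V.mordellWeilRank L))
    {N : ℕ} [NeZero N] {f : CuspForm (Gamma0 N) 2} (hf : IsNewformOf V f) (ϖ : ℚ)
    (hϖ : if Even (p / 2) then (ϖ : ℝ) * V.realPeriodRat = plusPeriod f
      else (ϖ : ℝ) * V.imaginaryPeriodRat = minusPeriod f)
    (Lη : IwasawaAlgebra p) (hL : IsQuadraticBranchPlusLFunction f p ϖ Lη)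
    (hne : PowerSeries.coeff (V.quadraticTwist ((-1) ^ (p / 2) * p)).mordellWeilRank Lη ≠ 0)
    (K₀ : Type) [Field K₀] [NumberField K₀] [IsCyclotomicExtension {p} ℚ K₀]
    [(galRange (K := ℚ) K₀).Normal] (ηq : absoluteGaloisGroup ℚ →* ℤˣ)
    (hηK : ∀ σ ∈ galRange (K := ℚ) K₀, ηq σ = 1) (hη1 : ηq ≠ 1)
    (κ : ZpExtension ℚ p) (γ : absoluteGaloisGroup ℚ) (hκ : κ.IsCyclotomic) (hγ : κ.IsTopGenerator γ)
    (hγK : γ ∈ galRange (K := ℚ) K₀) (hγc : IsCyclotomicVariable p γ)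
    (D : EtaSignedSelmerDualData V κ K₀ ℚ_[p] ηq γ 1) {g : IwasawaAlgebra p}
    (hg : D.charIdeal = Ideal.span {g}) :
    ((PowerSeries.X : IwasawaAlgebra p) ^ (V.quadraticTwist ((-1) ^ (p / 2) * p)).mordellWeilRank ∣ g ∧
      ¬ (PowerSeries.X : IwasawaAlgebra p) ^
          ((V.quadraticTwist ((-1) ^ (p / 2) * p)).mordellWeilRank + 1) ∣ g) ∧
    ((PowerSeries.X : IwasawaAlgebra p) ^ (V.quadraticTwist ((-1) ^ (p / 2) * p)).mordellWeilRank ∣ Lη ∧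
      ¬ (PowerSeries.X : IwasawaAlgebra p) ^
          ((V.quadraticTwist ((-1) ^ (p / 2) * p)).mordellWeilRank + 1) ∣ Lη) := by
  have hp2 : p ≠ 2 := by omega
  -- the Kato side at `η` (Thm. 4.1, `n = 0`): `g ∣ Lη`
  obtain ⟨-, hup⟩ := EtaSignedSelmerDualData.thm41_plus_of_facts h22 h41 hηK hη1 hp2 hgood hap hf
    ϖ hϖ Lη hL hκ hγ hγK hγc D
  have hgL : g ∣ Lη := by
    have h := hup hsurj
    rw [hg, Ideal.span_singleton_le_span_singleton] at h
    exact h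
  -- the `η`-rank bound: `T^r ∣ g`
  have hXg := X_pow_twistRank_dvd_etaCharGenerator_of_namedFacts_of_certV h12 h13 h22 hp5 hgood hap
    hsurj (fun f hf => hcertV f hf) hf K₀ ηq hηK hη1 κ γ hκ hγ hγK hγc D hg
  obtain ⟨hg', hL'⟩ := not_X_pow_succ_dvd_of_dvd_of_coeff_ne_zero hgL hne
  exact ⟨⟨hXg, hg'⟩, hXg.trans hgL, hL'⟩

end Pair

end Summit.BirchSwinnertonDyer.BirchSwinnertonDyer.Theorems

end
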